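import Literature.NumberTheory.Sieve.PairShiuCounting
import Literature.NumberTheory.Sieve.PairShiuLocal
import HarnessLib

/-!
# The bivariate Shiu bound: the class estimates

Topic `Literature/NumberTheory/Sieve`. Everything here is PROVED; no definition is introduced.
Shiu's classes (J. reine angew. Math. 313 (1980), §5) for the pair of linear forms `(n, mn + h)`:
every `1 ≤ n ≤ N` is cut through the factorisation of `Q(n) = n (mn + h)` at the tree's cut prime
`P_n = Shiu.cutPrime z (Q n)` (`z = w²`), `Q(n) = c d` with `c = c₁ c₂`, `c₁ = smoothPart P_n n`,
`c₂ = smoothPart P_n (mn + h)`; the sum `∑ f(n) g(mn + h)` over each class is bounded: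

* `class_small_le` — `Q(n) ≤ z`: at most `z` values of `n`;
* `class_H_le` — a large `h`-part of `n` or of `mn + h` (`> Y`): `O(N Y^{-1/2} 4^{ω(h)} + Y²)` values;
* `class_II_le` — `P_n ≤ w`, `c ≤ w`: a prime power `p^e ∥ Q(n)` with `p ≤ w < p^e`, `e ≥ 2`;
* `class_III_le` — `c > w`, `P_n ≤ L₀`: Rankin's trick over `L₀`-smooth pairs `(c₁, c₂)`;
* `class_I_le` — `P_n > w`: the cofactors have boundedly many prime factors and are counted by
  the two-dimensional sieve (`PairShiuCount.card_le`), the `h`-parts by `PairShiuLocal.sum_pairs_le`;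
* `class_IV_le` — `c > w`, `L₀ < P_n ≤ w`: as class I at the sifting level `z^{1/(r+1)}`, with
  Rankin's trick (uniform exponent `η = K₁ r / log z`) on the parts of `c₁, c₂` coprime to `h`.

## References

* P. Shiu, J. reine angew. Math. 313 (1980), 161–170, §5. [cite: Shiu1980, §5]
* K. Matomäki, J. Merikoski, IMRN 2023 (arXiv:2112.11412), Lemma 3.1. [cite: MatomakiMerikoski2023, Lemma 3.1]
-/

noncomputable section

open Finset Real

namespace Literature.NumberTheory.Sieve

namespace PairShiu

/-! ### Class "small": `Q(n) ≤ z` -/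

/-- **The initial segment**: `∑_{n ≤ N, n(mn+h) ≤ z} F(n) ≤ F_max · z` (`h ≥ 1`). [folklore] -/
theorem class_small_le {F : ℕ → ℝ} {m h N : ℕ} (hh : 1 ≤ h) {Fmax : ℝ}
    (hFmax0 : 0 ≤ Fmax) (hFmax : ∀ n ∈ Icc 1 N, F n ≤ Fmax) {z : ℝ} (hz : 0 ≤ z) :
    ∑ n ∈ (Icc 1 N).filter (fun n : ℕ => ((n * (m * n + h) : ℕ) : ℝ) ≤ z), F n ≤ Fmax * z := by
  set S := (Icc 1 N).filter (fun n : ℕ => ((n * (m * n + h) : ℕ) : ℝ) ≤ z) with hS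
  have hsub : S ⊆ Icc 1 ⌊z⌋₊ := by
    intro n hn
    rw [hS, Finset.mem_filter, Finset.mem_Icc] at hn
    rw [Finset.mem_Icc]
    refine ⟨hn.1.1, Nat.le_floor ?_⟩
    have h1 : (n : ℝ) ≤ ((n * (m * n + h) : ℕ) : ℝ) := by
      have : n ≤ n * (m * n + h) := Nat.le_mul_of_pos_right n (by omega)
      exact_mod_cast this
    exact h1.trans hn.2
  calc ∑ n ∈ S, F n ≤ ∑ n ∈ S, Fmax := Finset.sum_le_sum fun n hn => hFmax n (Finset.mem_filter.mp hn).1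
    _ = #S * Fmax := by rw [Finset.sum_const, nsmul_eq_mul]
    _ ≤ (⌊z⌋₊ : ℝ) * Fmax := by
        gcongr
        have := Finset.card_le_card hsub
        simp only [Nat.card_Icc, add_tsub_cancel_right] at this
        exact_mod_cast this
    _ ≤ z * Fmax := by gcongr; exact Nat.floor_le hz
    _ = Fmax * z := mul_comm _ _

/-! ### Class H: a large `h`-part -/

/-- **Large `h`-parts**: for `h ≠ 0`, `(m, h) = 1`, `Y ≥ 1`,
`∑_{n ≤ N : hPart_h(n) > Y ∨ hPart_h(mn+h) > Y} F(n) ≤ F_max (3 (N/√Y) 4^{ω(h)} + Y²)`. [folklore] -/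
theorem class_H_le {F : ℕ → ℝ} {m h N : ℕ} (hh : h ≠ 0) (hmh : m.Coprime h)
    {Fmax : ℝ} (hFmax0 : 0 ≤ Fmax) (hFmax : ∀ n ∈ Icc 1 N, F n ≤ Fmax) {Y : ℝ} (hY : 1 ≤ Y) :
    ∑ n ∈ (Icc 1 N).filter (fun n : ℕ =>
        Y < ((∏ q ∈ h.primeFactors, q ^ n.factorization q : ℕ) : ℝ) ∨
        Y < ((∏ q ∈ h.primeFactors, q ^ (m * n + h).factorization q : ℕ) : ℝ)), F n ≤
      Fmax * (3 * ((N : ℝ) / Real.sqrt Y * (4 : ℝ) ^ #h.primeFactors) + Y ^ 2) := by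
  set S := (Icc 1 N).filter (fun n : ℕ =>
        Y < ((∏ q ∈ h.primeFactors, q ^ n.factorization q : ℕ) : ℝ) ∨
        Y < ((∏ q ∈ h.primeFactors, q ^ (m * n + h).factorization q : ℕ) : ℝ)) with hS
  set S₁ := (Icc 1 N).filter (fun n : ℕ =>
        Y < ((∏ q ∈ h.primeFactors, q ^ n.factorization q : ℕ) : ℝ)) with hS₁
  set S₂ := (Icc 1 N).filter (fun n : ℕ =>
        Y < ((∏ q ∈ h.primeFactors, q ^ (m * n + h).factorization q : ℕ) : ℝ)) with hS₂
  have hcover : S ⊆ S₁ ∪ S₂ := by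
    intro n hn
    rw [hS, Finset.mem_filter] at hn
    rw [Finset.mem_union, hS₁, hS₂, Finset.mem_filter, Finset.mem_filter]
    rcases hn.2 with h1 | h2
    · exact Or.inl ⟨hn.1, h1⟩
    · exact Or.inr ⟨hn.1, h2⟩
  have h1 := card_hPart_gt_le N h hY
  have h2 := card_hPart_lin_gt_le N m hh hmh hY
  have hcard : (#S : ℝ) ≤ 3 * ((N : ℝ) / Real.sqrt Y * (4 : ℝ) ^ #h.primeFactors) + Y ^ 2 := by
    calc (#S : ℝ) ≤ #(S₁ ∪ S₂) := by exact_mod_cast Finset.card_le_card hcover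
      _ ≤ #S₁ + #S₂ := by exact_mod_cast Finset.card_union_le S₁ S₂
      _ ≤ _ := by rw [hS₁, hS₂]; linarith
  calc ∑ n ∈ S, F n ≤ ∑ n ∈ S, Fmax := Finset.sum_le_sum fun n hn => hFmax n (Finset.mem_filter.mp hn).1
    _ = #S * Fmax := by rw [Finset.sum_const, nsmul_eq_mul]
    _ ≤ (3 * ((N : ℝ) / Real.sqrt Y * (4 : ℝ) ^ #h.primeFactors) + Y ^ 2) * Fmax :=
        mul_le_mul_of_nonneg_right hcard hFmax0
    _ = _ := mul_comm _ _


/-! ### Class II: a large prime-power divisor of `Q(n)` -/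

/-- **Class II** (Shiu's `∑_{II}` for `Q(n) = n(mn+h)`): if `P_n ≤ w` and `c ≤ w` (`z = w²`) then
`P_n^v ∥ Q(n)` with `P_n^v > w`, so `v ≥ e_{P_n}`; hence `p^{e_p}` (if `p ∤ h`) or `p^{⌈e_p/2⌉}`
(if `p ∣ h`) divides `n` or `mn + h` for some prime `p ≤ w`, and counting multiples gives
`∑_{II} F ≤ F_max (2N (7 w^{-1/3} + ω(h)/√w) + w)`. [cite: Shiu1980, §5 (∑_II)] -/
theorem class_II_le {F : ℕ → ℝ} {m h N : ℕ} (hh : 1 ≤ h) (hmh : m.Coprime h)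
    {Fmax : ℝ} (hFmax0 : 0 ≤ Fmax) (hFmax : ∀ n ∈ Icc 1 N, F n ≤ Fmax) {w : ℝ} (hw : 2 ≤ w) :
    ∑ n ∈ (Icc 1 N).filter (fun n : ℕ => w * w < ((n * (m * n + h) : ℕ) : ℝ) ∧
        (Shiu.cutPrime (w * w) (n * (m * n + h)) : ℝ) ≤ w ∧
        (Shiu.cPart (w * w) (n * (m * n + h)) : ℝ) ≤ w), F n ≤
      Fmax * (2 * N * (7 * w ^ (-(1 / 3 : ℝ)) + #h.primeFactors / Real.sqrt w) + w) := by
  set S := (Icc 1 N).filter (fun n : ℕ => w * w < ((n * (m * n + h) : ℕ) : ℝ) ∧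
        (Shiu.cutPrime (w * w) (n * (m * n + h)) : ℝ) ≤ w ∧
        (Shiu.cPart (w * w) (n * (m * n + h)) : ℝ) ≤ w) with hS
  have hw0 : 0 < w := by linarith
  have hw1 : 1 ≤ w := by linarith
  have hz1 : 1 ≤ w * w := by nlinarith
  have hsw : 0 < Real.sqrt w := Real.sqrt_pos.mpr hw0
  -- the exponent at `p`
  set t : ℕ → ℕ := fun p => if p ∣ h then (Shiu.ePow w p + 1) / 2 else Shiu.ePow w p with ht
  have ht1 : ∀ p, 1 ≤ t p := by
    intro p
    simp only [ht, Shiu.ePow]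
    split_ifs <;> omega
  set U : ℕ → Finset ℕ := fun p => (Icc 1 N).filter (fun n : ℕ => p ^ t p ∣ n ∨ p ^ t p ∣ m * n + h)
    with hU
  -- Step 1: the cover
  have hcover : S ⊆ (Nat.primesLE ⌊w⌋₊).biUnion U := by
    intro n hn
    rw [hS, Finset.mem_filter, Finset.mem_Icc] at hn
    obtain ⟨⟨hn1, hnN⟩, hzQ, hPw, hcw⟩ := hn
    have hn0 : n ≠ 0 := by omega
    set Qn := n * (m * n + h) with hQn
    have hQ2 : 2 ≤ Qn := by
      have h4 : (4 : ℝ) ≤ w * w := by nlinarith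
      have : (4 : ℝ) < (Qn : ℝ) := lt_of_le_of_lt h4 hzQ
      exact_mod_cast (show (2 : ℝ) ≤ Qn by linarith)
    obtain ⟨hPmem, -⟩ := Shiu.cutPrime_mem (n := Qn) (z := w * w) hQ2 hz1
    set P := Shiu.cutPrime (w * w) Qn with hP
    have hPp : P.Prime := Nat.prime_of_mem_primeFactors hPmem
    have hcut := Shiu.lt_cPart_mul_pow (n := Qn) (z := w * w) hQ2 hz1 hzQ
    set v := Qn.factorization P with hv
    -- `w < P^v`
    have hwv : w < (P : ℝ) ^ v := by
      by_contra hle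
      push Not at hle
      have : (Shiu.cPart (w * w) Qn : ℝ) * (P : ℝ) ^ v ≤ w * w :=
        mul_le_mul hcw hle (by positivity) hw0.le
      linarith
    -- `e_P ≤ v`
    have hev : Shiu.ePow w P ≤ v := by
      have h1 := Shiu.pow_ePow_sub_one_le hw1 P
      have h2 : (P : ℝ) ^ (Shiu.ePow w P - 1) < (P : ℝ) ^ v := lt_of_le_of_lt h1 hwv
      have h3 : P ^ (Shiu.ePow w P - 1) < P ^ v := by exact_mod_cast h2
      have := (Nat.pow_lt_pow_iff_right hPp.one_lt).mp h3
      omega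
    rw [Finset.mem_biUnion]
    refine ⟨P, Nat.mem_primesLE.mpr ⟨Nat.le_floor hPw, hPp⟩, ?_⟩
    rw [hU, Finset.mem_filter, Finset.mem_Icc]
    refine ⟨⟨hn1, hnN⟩, ?_⟩
    simp only [ht]
    by_cases hPh : P ∣ h
    · rw [if_pos hPh]
      exact pow_half_dvd_or hPp (by omega) hn0 hev
    · rw [if_neg hPh]
      exact pow_dvd_or_of_not_dvd hPp hPh hn0 hev
  -- Step 2: the size of each `U p`
  have hUcard : ∀ p ∈ Nat.primesLE ⌊w⌋₊, (#(U p) : ℝ) ≤ 2 * N / (p : ℝ) ^ t p + 1 := by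
    intro p hp
    obtain ⟨-, hpp⟩ := Nat.mem_primesLE.mp hp
    have hpt : 0 < p ^ t p := pow_pos hpp.pos _
    have hsplit : U p ⊆ ((Icc 1 N).filter fun n : ℕ => p ^ t p ∣ n) ∪
        ((Icc 1 N).filter fun n : ℕ => p ^ t p ∣ m * n + h) := by
      intro n hn
      rw [hU, Finset.mem_filter] at hn
      rw [Finset.mem_union, Finset.mem_filter, Finset.mem_filter]
      rcases hn.2 with h1 | h2
      · exact Or.inl ⟨hn.1, h1⟩
      · exact Or.inr ⟨hn.1, h2⟩
    have hA : (#((Icc 1 N).filter fun n : ℕ => p ^ t p ∣ n) : ℝ) ≤ N / (p : ℝ) ^ t p := by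
      have := card_multiples_le N hpt
      push_cast at this
      exact this
    have hB : (#((Icc 1 N).filter fun n : ℕ => p ^ t p ∣ m * n + h) : ℝ) ≤ N / (p : ℝ) ^ t p + 1 := by
      by_cases hpm : p ∣ m
      · -- then the set is empty: `p ∣ mn + h` would give `p ∣ h`
        have hempty : ((Icc 1 N).filter fun n : ℕ => p ^ t p ∣ m * n + h) = ∅ := by
          rw [Finset.filter_eq_empty_iff]
          intro n _ hdvd
          have h1 : p ∣ m * n + h := (dvd_pow_self p (by have := ht1 p; omega)).trans hdvd
          have h2 : p ∣ h := (Nat.dvd_add_right (dvd_mul_of_dvd_left hpm n)).mp h1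
          have := Nat.dvd_gcd hpm h2
          rw [hmh.gcd_eq_one] at this
          exact hpp.one_lt.ne' (Nat.dvd_one.mp this)
        rw [hempty, Finset.card_empty, Nat.cast_zero]
        positivity
      · have hcop : (p ^ t p).Coprime m := Nat.Coprime.pow_left _ (hpp.coprime_iff_not_dvd.mpr hpm)
        have := card_lin_multiples_le N m h hpt hcop
        push_cast at this
        exact this
    calc (#(U p) : ℝ) ≤ #(((Icc 1 N).filter fun n : ℕ => p ^ t p ∣ n) ∪
          ((Icc 1 N).filter fun n : ℕ => p ^ t p ∣ m * n + h)) := by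
          exact_mod_cast Finset.card_le_card hsplit
      _ ≤ #((Icc 1 N).filter fun n : ℕ => p ^ t p ∣ n) +
          #((Icc 1 N).filter fun n : ℕ => p ^ t p ∣ m * n + h) := by
          exact_mod_cast Finset.card_union_le _ _
      _ ≤ N / (p : ℝ) ^ t p + (N / (p : ℝ) ^ t p + 1) := add_le_add hA hB
      _ = 2 * N / (p : ℝ) ^ t p + 1 := by ring
  -- Step 3: the reciprocal prime powers
  have hrecip : ∀ p ∈ Nat.primesLE ⌊w⌋₊, 1 / (p : ℝ) ^ t p ≤
      ((p : ℝ) ^ Shiu.ePow w p)⁻¹ + (if p ∣ h then 1 / Real.sqrt w else 0) := by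
    intro p hp
    obtain ⟨hpw, hpp⟩ := Nat.mem_primesLE.mp hp
    have hp0 : (0 : ℝ) < p := by exact_mod_cast hpp.pos
    have hinv0 : 0 ≤ ((p : ℝ) ^ Shiu.ePow w p)⁻¹ := by positivity
    simp only [ht]
    by_cases hph : p ∣ h
    · rw [if_pos hph, if_pos hph]
      -- `√w ≤ p^{⌈e/2⌉}`
      have hlt := Shiu.lt_pow_ePow w hpp.one_lt
      have h2t : Shiu.ePow w p ≤ 2 * ((Shiu.ePow w p + 1) / 2) := by omega
      have hge : w ≤ ((p : ℝ) ^ ((Shiu.ePow w p + 1) / 2)) ^ 2 := by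
        rw [← pow_mul, mul_comm]
        exact hlt.le.trans (pow_le_pow_right₀ (by exact_mod_cast hpp.one_lt.le) h2t)
      have hsq : Real.sqrt w ≤ (p : ℝ) ^ ((Shiu.ePow w p + 1) / 2) := by
        rw [← Real.sqrt_sq (by positivity : (0 : ℝ) ≤ (p : ℝ) ^ ((Shiu.ePow w p + 1) / 2))]
        exact Real.sqrt_le_sqrt hge
      have : 1 / (p : ℝ) ^ ((Shiu.ePow w p + 1) / 2) ≤ 1 / Real.sqrt w :=
        one_div_le_one_div_of_le hsw hsq
      linarith
    · rw [if_neg hph, if_neg hph, add_zero, one_div]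
  -- Step 4: assemble
  have hcount : (#S : ℝ) ≤ 2 * N * (7 * w ^ (-(1 / 3 : ℝ)) + #h.primeFactors / Real.sqrt w) + w := by
    calc (#S : ℝ) ≤ #((Nat.primesLE ⌊w⌋₊).biUnion U) := by exact_mod_cast Finset.card_le_card hcover
      _ ≤ ∑ p ∈ Nat.primesLE ⌊w⌋₊, (#(U p) : ℝ) := by exact_mod_cast Finset.card_biUnion_le
      _ ≤ ∑ p ∈ Nat.primesLE ⌊w⌋₊, (2 * N / (p : ℝ) ^ t p + 1) := Finset.sum_le_sum hUcard
      _ = 2 * N * ∑ p ∈ Nat.primesLE ⌊w⌋₊, 1 / (p : ℝ) ^ t p + #(Nat.primesLE ⌊w⌋₊) := by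
          rw [Finset.sum_add_distrib, Finset.sum_const, nsmul_eq_mul, mul_one, Finset.mul_sum]
          congr 1
          refine Finset.sum_congr rfl fun p _ => ?_
          ring
      _ ≤ 2 * N * (∑ p ∈ Nat.primesLE ⌊w⌋₊, (((p : ℝ) ^ Shiu.ePow w p)⁻¹ +
            (if p ∣ h then 1 / Real.sqrt w else 0))) + w := by
          refine add_le_add (mul_le_mul_of_nonneg_left (Finset.sum_le_sum hrecip) (by positivity)) ?_
          calc (#(Nat.primesLE ⌊w⌋₊) : ℝ) ≤ ⌊w⌋₊ := by
                have : Nat.primesLE ⌊w⌋₊ ⊆ Finset.Icc 1 ⌊w⌋₊ := fun p hp => by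
                  obtain ⟨hpw, hpp⟩ := Nat.mem_primesLE.mp hp
                  exact Finset.mem_Icc.mpr ⟨hpp.one_lt.le, hpw⟩
                have h := Finset.card_le_card this
                simp only [Nat.card_Icc, add_tsub_cancel_right] at h
                exact_mod_cast h
            _ ≤ w := Nat.floor_le hw0.le
      _ ≤ 2 * N * (7 * w ^ (-(1 / 3 : ℝ)) + #h.primeFactors / Real.sqrt w) + w := by
          refine add_le_add (mul_le_mul_of_nonneg_left ?_ (by positivity)) le_rfl
          rw [Finset.sum_add_distrib]
          refine add_le_add (Shiu.sum_inv_pow_ePow_le hw1) ?_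
          rw [Finset.sum_ite, Finset.sum_const_zero, add_zero, Finset.sum_const, nsmul_eq_mul,
            mul_one_div]
          refine div_le_div_of_nonneg_right ?_ hsw.le
          have hsub : (Nat.primesLE ⌊w⌋₊).filter (fun p => p ∣ h) ⊆ h.primeFactors := by
            intro p hp
            rw [Finset.mem_filter] at hp
            exact Nat.mem_primeFactors.mpr ⟨(Nat.mem_primesLE.mp hp.1).2, hp.2, by omega⟩
          exact_mod_cast Finset.card_le_card hsub
  calc ∑ n ∈ S, F n ≤ ∑ n ∈ S, Fmax := Finset.sum_le_sum fun n hn => hFmax n (Finset.mem_filter.mp hn).1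
    _ = #S * Fmax := by rw [Finset.sum_const, nsmul_eq_mul]
    _ ≤ (2 * N * (7 * w ^ (-(1 / 3 : ℝ)) + #h.primeFactors / Real.sqrt w) + w) * Fmax :=
        mul_le_mul_of_nonneg_right hcount hFmax0
    _ = _ := mul_comm _ _


/-! ### Class III: a large, very smooth `c` -/

/-- Reciprocal square roots over `s`-factored numbers: `∑_{t ∈ S} 1/√t ≤ 4^{#s}`. [folklore] -/
theorem sum_inv_sqrt_le_four_pow_of_factored {s : Finset ℕ} (hs : ∀ p ∈ s, p.Prime) {S : Finset ℕ}
    (hS : ∀ t ∈ S, t ∈ Nat.factoredNumbers s) :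
    ∑ t ∈ S, 1 / Real.sqrt t ≤ (4 : ℝ) ^ #s := by
  set g : ℕ → ℝ := fun t => 1 / Real.sqrt t with hg
  have hg1 : g 1 = 1 := by simp [hg]
  have hgmul : ∀ {a b : ℕ}, Nat.Coprime a b → g (a * b) = g a * g b := by
    intro a b _
    simp only [hg, Nat.cast_mul]
    rw [Real.sqrt_mul (Nat.cast_nonneg a), one_div_mul_one_div]
  have hg0 : ∀ n, 0 ≤ g n := fun n => by simp only [hg]; positivity
  have hgpow : ∀ p a : ℕ, g (p ^ a) = (1 / Real.sqrt p) ^ a := by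
    intro p a
    simp only [hg, Nat.cast_pow]
    rw [Real.sqrt_eq_rpow, Real.sqrt_eq_rpow, Shiu.rpow_pow_comm, one_div_pow]
  have hratio : ∀ {p : ℕ}, p.Prime → 0 ≤ 1 / Real.sqrt p ∧ 1 / Real.sqrt p ≤ 3 / 4 := by
    intro p hp
    refine ⟨by positivity, ?_⟩
    have hp2 : (2 : ℝ) ≤ p := by exact_mod_cast hp.two_le
    have hsq : Real.sqrt 2 ≤ Real.sqrt p := Real.sqrt_le_sqrt hp2
    have h2 : (4 / 3 : ℝ) ≤ Real.sqrt 2 := by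
      rw [show (4 / 3 : ℝ) = Real.sqrt ((4 / 3) ^ 2) by rw [Real.sqrt_sq (by norm_num)]]
      exact Real.sqrt_le_sqrt (by norm_num)
    rw [div_le_iff₀ (by linarith), ← div_le_iff₀' (by norm_num)]
    linarith
  have hsum : ∀ {p : ℕ}, p.Prime → Summable (fun a : ℕ => g (p ^ a)) := by
    intro p hp
    simp_rw [hgpow p]
    obtain ⟨h0, h34⟩ := hratio hp
    exact summable_geometric_of_lt_one h0 (by linarith)
  refine (BombieriSieve.sum_le_prod_tsum_of_factored hg1 hgmul hg0 hsum hs hS).trans ?_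
  rw [← Finset.prod_const]
  refine Finset.prod_le_prod (fun p _ => tsum_nonneg fun a => hg0 _) fun p hp => ?_
  obtain ⟨h0, h34⟩ := hratio (hs p hp)
  simp_rw [hgpow p]
  rw [tsum_geometric_of_lt_one h0 (by linarith)]
  rw [inv_le_comm₀ (by linarith) (by norm_num)]
  linarith

/-- **Class III** (Shiu's `∑_{III}` for `Q(n) = n(mn+h)`): `c = c₁c₂ > w` with `P_n ≤ L₀`, and the
`h`-parts of `n`, `mn + h` at most `Y`. The fibre over `(c₁, c₂)` is counted by
`PairShiuCount.card_le` (with empty sifting range; `gcd(mc₁, c₂) ≤ Y`), and Rankin's trick with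
exponent `1/2` over the `L₀`-smooth pairs gives
`∑_{III} F ≤ F_max C (N Y w^{-1/2} 16^{⌊L₀⌋+1} + w⁴)`. [cite: Shiu1980, §5 (∑_III)] -/
theorem class_III_le : ∃ C : ℝ, 0 < C ∧ ∀ {F : ℕ → ℝ} {m h N : ℕ}, 1 ≤ h → 1 ≤ m → m.Coprime h →
    (∀ n, 0 ≤ F n) → ∀ {Fmax : ℝ}, 0 ≤ Fmax → (∀ n ∈ Icc 1 N, F n ≤ Fmax) →
    ∀ {w L₀ Y : ℝ}, 2 ≤ w → 1 ≤ Y →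
    ∑ n ∈ (Icc 1 N).filter (fun n : ℕ => w * w < ((n * (m * n + h) : ℕ) : ℝ) ∧
        (Shiu.cutPrime (w * w) (n * (m * n + h)) : ℝ) ≤ L₀ ∧
        w < (Shiu.cPart (w * w) (n * (m * n + h)) : ℝ) ∧
        ((∏ q ∈ h.primeFactors, q ^ n.factorization q : ℕ) : ℝ) ≤ Y ∧
        ((∏ q ∈ h.primeFactors, q ^ (m * n + h).factorization q : ℕ) : ℝ) ≤ Y), F n ≤
      Fmax * C * ((N : ℝ) * Y / Real.sqrt w * (16 : ℝ) ^ (⌊L₀⌋₊ + 1) + w ^ 4) := by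
  obtain ⟨C₀, hC₀, hcard⟩ := PairShiuCount.card_le
  refine ⟨C₀ * (2 + 2 ^ (19 : ℕ) * Real.log 2 ^ 2), by positivity, ?_⟩
  intro F m h N hh hm hmh hF0 Fmax hFmax0 hFmax w L₀ Y hw hY
  set S := (Icc 1 N).filter (fun n : ℕ => w * w < ((n * (m * n + h) : ℕ) : ℝ) ∧
        (Shiu.cutPrime (w * w) (n * (m * n + h)) : ℝ) ≤ L₀ ∧
        w < (Shiu.cPart (w * w) (n * (m * n + h)) : ℝ) ∧
        ((∏ q ∈ h.primeFactors, q ^ n.factorization q : ℕ) : ℝ) ≤ Y ∧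
        ((∏ q ∈ h.primeFactors, q ^ (m * n + h).factorization q : ℕ) : ℝ) ≤ Y) with hS
  have hw0 : 0 < w := by linarith
  have hz1 : 1 ≤ w * w := by nlinarith
  have hsw : 0 < Real.sqrt w := Real.sqrt_pos.mpr hw0
  set Bd : ℕ := ⌊L₀⌋₊ + 1 with hBd
  -- the fibre map
  set pr : ℕ → ℕ × ℕ := fun n =>
    (smoothPart (Shiu.cutPrime (w * w) (n * (m * n + h))) n,
     smoothPart (Shiu.cutPrime (w * w) (n * (m * n + h))) (m * n + h)) with hpr
  set Pairs := ((Icc 1 ⌊w * w⌋₊) ×ˢ (Icc 1 ⌊w * w⌋₊)).filter (fun c : ℕ × ℕ =>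
    w < ((c.1 * c.2 : ℕ) : ℝ) ∧ c.1 ∈ Nat.smoothNumbers Bd ∧ c.2 ∈ Nat.smoothNumbers Bd) with hPairs
  -- facts about the elements of `S`
  have hSfacts : ∀ n ∈ S, n ≠ 0 ∧ (1 ≤ n ∧ n ≤ N) ∧
      (Shiu.cutPrime (w * w) (n * (m * n + h))).Prime ∧
      Shiu.cPart (w * w) (n * (m * n + h)) = (pr n).1 * (pr n).2 ∧
      ((pr n).1 * (pr n).2 : ℝ) ≤ w * w ∧ w < ((pr n).1 * (pr n).2 : ℝ) ∧
      (Shiu.cutPrime (w * w) (n * (m * n + h)) : ℝ) ≤ L₀ ∧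
      ((∏ q ∈ h.primeFactors, q ^ n.factorization q : ℕ) : ℝ) ≤ Y := by
    intro n hn
    rw [hS, Finset.mem_filter, Finset.mem_Icc] at hn
    obtain ⟨⟨hn1, hnN⟩, hzQ, hPL, hcw, hY1, -⟩ := hn
    have hn0 : n ≠ 0 := by omega
    have hL0 : m * n + h ≠ 0 := by omega
    set Qn := n * (m * n + h) with hQn
    have hQ2 : 2 ≤ Qn := by
      have h4 : (4 : ℝ) ≤ w * w := by nlinarith
      have : (4 : ℝ) < (Qn : ℝ) := lt_of_le_of_lt h4 hzQ
      exact_mod_cast (show (2 : ℝ) ≤ Qn by linarith)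
    obtain ⟨hPmem, hcz⟩ := Shiu.cutPrime_mem (n := Qn) (z := w * w) hQ2 hz1
    have hPp := Nat.prime_of_mem_primeFactors hPmem
    have hsplit : Shiu.cPart (w * w) Qn = (pr n).1 * (pr n).2 := by
      simp only [hpr, Shiu.cPart, hQn]
      exact smoothPart_mul hn0 hL0 _
    refine ⟨hn0, ⟨hn1, hnN⟩, hPp, hsplit, ?_, ?_, hPL, hY1⟩
    · have := hcz; rw [hsplit] at this; exact_mod_cast this
    · have := hcw; rw [hsplit] at this; exact_mod_cast this
  have hmaps : ∀ n ∈ S, pr n ∈ Pairs := by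
    intro n hn
    obtain ⟨hn0, -, hPp, -, hcz, hcw, hPL, -⟩ := hSfacts n hn
    have hc1 : (pr n).1 ≠ 0 := smoothPart_ne_zero _ _
    have hc2 : (pr n).2 ≠ 0 := smoothPart_ne_zero _ _
    have hc1' : (1 : ℝ) ≤ (pr n).1 := by exact_mod_cast Nat.one_le_iff_ne_zero.mpr hc1
    have hc2' : (1 : ℝ) ≤ (pr n).2 := by exact_mod_cast Nat.one_le_iff_ne_zero.mpr hc2
    have hPB : Shiu.cutPrime (w * w) (n * (m * n + h)) ≤ Bd := by
      rw [hBd]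
      have : Shiu.cutPrime (w * w) (n * (m * n + h)) ≤ ⌊L₀⌋₊ := Nat.le_floor hPL
      omega
    rw [hPairs, Finset.mem_filter, Finset.mem_product, Finset.mem_Icc, Finset.mem_Icc]
    refine ⟨⟨⟨Nat.one_le_iff_ne_zero.mpr hc1, Nat.le_floor ?_⟩,
      ⟨Nat.one_le_iff_ne_zero.mpr hc2, Nat.le_floor ?_⟩⟩, ?_, ?_, ?_⟩
    · nlinarith
    · nlinarith
    · push_cast; exact hcw
    · exact Nat.smoothNumbers_mono hPB (smoothPart_mem_smoothNumbers _ _)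
    · exact Nat.smoothNumbers_mono hPB (smoothPart_mem_smoothNumbers _ _)
  -- the fibres
  have hfib : ∀ c ∈ Pairs, ∑ n ∈ S.filter (fun n => pr n = c), F n ≤
      Fmax * (C₀ * ((N : ℝ) * Y / ((c.1 : ℝ) * c.2) + 1) + C₀ * (2 : ℝ) ^ (19 : ℕ) * Real.log 2 ^ 2) := by
    intro c hc
    rw [hPairs, Finset.mem_filter, Finset.mem_product, Finset.mem_Icc, Finset.mem_Icc] at hc
    obtain ⟨⟨⟨hc1, -⟩, ⟨hc2, -⟩⟩, -, -, -⟩ := hc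
    set Sc := S.filter (fun n => pr n = c) with hSc
    rcases Sc.eq_empty_or_nonempty with hempty | ⟨n₀, hn₀⟩
    · rw [hempty, Finset.sum_empty]
      have : 0 ≤ C₀ * ((N : ℝ) * Y / ((c.1 : ℝ) * c.2) + 1) + C₀ * (2 : ℝ) ^ (19 : ℕ) * Real.log 2 ^ 2 := by
        positivity
      positivity
    -- the containing set, with trivial sifting range `P = 1`
    set D := (Icc 1 N).filter fun n : ℕ => c.1 ∣ n ∧ c.2 ∣ m * n + h ∧ (n / c.1).Coprime 1 ∧
      ((m * n + h) / c.2).Coprime 1 with hD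
    have hsub : Sc ⊆ D := by
      intro n hn
      rw [hSc, Finset.mem_filter] at hn
      obtain ⟨hnS, hnc⟩ := hn
      obtain ⟨hn0, hnI, -, -, -, -, -, -⟩ := hSfacts n hnS
      rw [hD, Finset.mem_filter, Finset.mem_Icc]
      refine ⟨hnI, ?_, ?_, Nat.coprime_one_right _, Nat.coprime_one_right _⟩
      · rw [← hnc]; exact smoothPart_dvd hn0 _
      · rw [← hnc]; exact smoothPart_dvd (by omega) _
    have hDne : D.Nonempty := ⟨n₀, hsub hn₀⟩
    have hcount := hcard N m h c.1 c.2 2 1 le_rfl (one_dvd _) odd_one hm hh hc1 hc2 hDne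
    simp only [Nat.primeFactors_one, Finset.filter_empty, Finset.prod_empty, mul_one] at hcount
    -- `gcd(m c₁, c₂) ≤ Y` via `n₀`
    have hG : (Nat.gcd (m * c.1) c.2 : ℝ) ≤ Y := by
      have hn₀S : n₀ ∈ S := (Finset.mem_filter.mp hn₀).1
      have hn₀c : pr n₀ = c := (Finset.mem_filter.mp hn₀).2
      obtain ⟨hn₀0, -, -, -, -, -, -, hY₀⟩ := hSfacts n₀ hn₀S
      have h1 : c.1 ∣ n₀ := by rw [← hn₀c]; exact smoothPart_dvd hn₀0 _
      have h2 : c.2 ∣ m * n₀ + h := by rw [← hn₀c]; exact smoothPart_dvd (by omega) _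
      have h3 : Nat.gcd (m * c.1) c.2 ∣ Nat.gcd n₀ h := by
        have a : Nat.gcd (m * c.1) c.2 ∣ m * n₀ := (Nat.gcd_dvd_left _ _).trans (mul_dvd_mul_left m h1)
        have b : Nat.gcd (m * c.1) c.2 ∣ m * n₀ + h := (Nat.gcd_dvd_right _ _).trans h2
        have hab := Nat.dvd_gcd a b
        rw [show m * n₀ + h = h + 1 * (m * n₀) by ring, Nat.gcd_add_mul_right_right,
          hmh.gcd_mul_left_cancel n₀] at hab
        exact hab
      have h4 : Nat.gcd n₀ h ∣ ∏ q ∈ h.primeFactors, q ^ n₀.factorization q :=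
        dvd_hPart_of_dvd hn₀0 (Nat.gcd_dvd_left _ _)
          (Nat.primeFactors_mono (Nat.gcd_dvd_right _ _) (by omega))
      have h5 : Nat.gcd (m * c.1) c.2 ≤ ∏ q ∈ h.primeFactors, q ^ n₀.factorization q :=
        Nat.le_of_dvd (Nat.pos_of_ne_zero (hPart_ne_zero h n₀)) (h3.trans h4)
      exact le_trans (by exact_mod_cast h5) hY₀
    have hc10 : (0 : ℝ) < c.1 := by exact_mod_cast hc1
    have hc20 : (0 : ℝ) < c.2 := by exact_mod_cast hc2
    have hDle : (#D : ℝ) ≤ C₀ * ((N : ℝ) * Y / ((c.1 : ℝ) * c.2) + 1) + C₀ * (2 : ℝ) ^ (19 : ℕ) * Real.log 2 ^ 2 := by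
      refine hcount.trans (add_le_add (mul_le_mul_of_nonneg_left (add_le_add ?_ le_rfl) hC₀.le) le_rfl)
      rw [mul_div_assoc, mul_div_assoc]
      exact mul_le_mul_of_nonneg_left (div_le_div_of_nonneg_right hG (by positivity)) (Nat.cast_nonneg N)
    calc ∑ n ∈ Sc, F n ≤ ∑ n ∈ Sc, Fmax := Finset.sum_le_sum fun n hn =>
          hFmax n (Finset.mem_filter.mp (Finset.mem_filter.mp hn).1).1
      _ = #Sc * Fmax := by rw [Finset.sum_const, nsmul_eq_mul]
      _ ≤ #D * Fmax := by gcongr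
      _ ≤ _ := by rw [mul_comm]; exact mul_le_mul_of_nonneg_left hDle hFmax0
  -- Rankin over the pairs
  have hrankin : ∑ c ∈ Pairs, 1 / ((c.1 : ℝ) * c.2) ≤ 1 / Real.sqrt w * (16 : ℝ) ^ Bd := by
    have hpt : ∀ c ∈ Pairs, 1 / ((c.1 : ℝ) * c.2) ≤ 1 / Real.sqrt w * ((1 / Real.sqrt c.1) * (1 / Real.sqrt c.2)) := by
      intro c hc
      rw [hPairs, Finset.mem_filter, Finset.mem_product, Finset.mem_Icc, Finset.mem_Icc] at hc
      obtain ⟨⟨⟨hc1, -⟩, ⟨hc2, -⟩⟩, hwc, -, -⟩ := hc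
      push_cast at hwc
      have hc10 : (0 : ℝ) < c.1 := by exact_mod_cast hc1
      have hc20 : (0 : ℝ) < c.2 := by exact_mod_cast hc2
      have hs1 : Real.sqrt c.1 * Real.sqrt c.1 = c.1 := Real.mul_self_sqrt hc10.le
      have hs2 : Real.sqrt c.2 * Real.sqrt c.2 = c.2 := Real.mul_self_sqrt hc20.le
      have hsqw : Real.sqrt w ≤ Real.sqrt c.1 * Real.sqrt c.2 := by
        rw [← Real.sqrt_mul hc10.le]
        exact Real.sqrt_le_sqrt hwc.le
      rw [one_div_mul_one_div, one_div_mul_one_div]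
      refine one_div_le_one_div_of_le (by positivity) ?_
      calc Real.sqrt w * (Real.sqrt c.1 * Real.sqrt c.2)
          ≤ (Real.sqrt c.1 * Real.sqrt c.2) * (Real.sqrt c.1 * Real.sqrt c.2) :=
            mul_le_mul_of_nonneg_right hsqw (by positivity)
        _ = (Real.sqrt c.1 * Real.sqrt c.1) * (Real.sqrt c.2 * Real.sqrt c.2) := by ring
        _ = (c.1 : ℝ) * c.2 := by rw [hs1, hs2]
    refine (Finset.sum_le_sum hpt).trans ?_
    rw [← Finset.mul_sum]
    refine mul_le_mul_of_nonneg_left ?_ (by positivity)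
    -- drop the filter and factor the double sum
    have hprimes : ∀ p ∈ Nat.primesBelow Bd, p.Prime := fun p hp => (Nat.mem_primesBelow.mp hp).2
    set T := (Icc 1 ⌊w * w⌋₊).filter (fun c : ℕ => c ∈ Nat.smoothNumbers Bd) with hT
    have hTfac : ∀ t ∈ T, t ∈ Nat.factoredNumbers (Nat.primesBelow Bd) := by
      intro t ht
      rw [hT, Finset.mem_filter] at ht
      rw [← Nat.smoothNumbers_eq_factoredNumbers_primesBelow]
      exact ht.2
    have hTsum := sum_inv_sqrt_le_four_pow_of_factored hprimes hTfac
    have hcardB : #(Nat.primesBelow Bd) ≤ Bd := by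
      have : Nat.primesBelow Bd ⊆ Finset.range Bd := fun p hp => Finset.mem_range.mpr (Nat.mem_primesBelow.mp hp).1
      exact (Finset.card_le_card this).trans (Finset.card_range Bd).le
    have hTsum' : ∑ t ∈ T, 1 / Real.sqrt t ≤ (4 : ℝ) ^ Bd :=
      hTsum.trans (pow_le_pow_right₀ (by norm_num) hcardB)
    have hT0 : 0 ≤ ∑ t ∈ T, 1 / Real.sqrt t := Finset.sum_nonneg fun t _ => by positivity
    calc ∑ c ∈ Pairs, 1 / Real.sqrt c.1 * (1 / Real.sqrt c.2)
        ≤ ∑ c ∈ T ×ˢ T, 1 / Real.sqrt c.1 * (1 / Real.sqrt c.2) := by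
          refine Finset.sum_le_sum_of_subset_of_nonneg ?_ fun c _ _ => by positivity
          intro c hc
          rw [hPairs, Finset.mem_filter, Finset.mem_product] at hc
          rw [Finset.mem_product, hT, Finset.mem_filter, Finset.mem_filter]
          exact ⟨⟨hc.1.1, hc.2.2.1⟩, ⟨hc.1.2, hc.2.2.2⟩⟩
      _ = (∑ t ∈ T, 1 / Real.sqrt t) * ∑ t ∈ T, 1 / Real.sqrt t := by
          rw [Finset.sum_product, Finset.sum_mul_sum]
      _ ≤ (4 : ℝ) ^ Bd * (4 : ℝ) ^ Bd := mul_le_mul hTsum' hTsum' hT0 (by positivity)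
      _ = (16 : ℝ) ^ Bd := by rw [← mul_pow]; norm_num
  have hPairsCard : (#Pairs : ℝ) ≤ w ^ 4 := by
    calc (#Pairs : ℝ) ≤ #((Icc 1 ⌊w * w⌋₊) ×ˢ (Icc 1 ⌊w * w⌋₊)) := by
          rw [hPairs]; exact_mod_cast Finset.card_filter_le _ _
      _ = (⌊w * w⌋₊ : ℝ) * ⌊w * w⌋₊ := by
          rw [Finset.card_product]; simp
      _ ≤ (w * w) * (w * w) := by
          have := Nat.floor_le (by positivity : (0 : ℝ) ≤ w * w)
          exact mul_le_mul this this (Nat.cast_nonneg _) (by positivity)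
      _ = w ^ 4 := by ring
  -- assemble
  rw [← Finset.sum_fiberwise_of_maps_to hmaps]
  calc ∑ c ∈ Pairs, ∑ n ∈ S.filter (fun n => pr n = c), F n
      ≤ ∑ c ∈ Pairs, Fmax * (C₀ * ((N : ℝ) * Y / ((c.1 : ℝ) * c.2) + 1) +
          C₀ * (2 : ℝ) ^ (19 : ℕ) * Real.log 2 ^ 2) := Finset.sum_le_sum hfib
    _ = Fmax * C₀ * ((N : ℝ) * Y * ∑ c ∈ Pairs, 1 / ((c.1 : ℝ) * c.2)) +
          Fmax * C₀ * (1 + (2 : ℝ) ^ (19 : ℕ) * Real.log 2 ^ 2) * #Pairs := by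
          have hpt : ∀ c ∈ Pairs, Fmax * (C₀ * ((N : ℝ) * Y / ((c.1 : ℝ) * c.2) + 1) +
              C₀ * (2 : ℝ) ^ (19 : ℕ) * Real.log 2 ^ 2) =
              Fmax * C₀ * ((N : ℝ) * Y) * (1 / ((c.1 : ℝ) * c.2)) +
                Fmax * C₀ * (1 + (2 : ℝ) ^ (19 : ℕ) * Real.log 2 ^ 2) := by
            intro c _; ring
          rw [Finset.sum_congr rfl hpt, Finset.sum_add_distrib, Finset.sum_const, nsmul_eq_mul,
            ← Finset.mul_sum]
          ring
    _ ≤ Fmax * C₀ * ((N : ℝ) * Y * (1 / Real.sqrt w * (16 : ℝ) ^ Bd)) +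
          Fmax * C₀ * (1 + (2 : ℝ) ^ (19 : ℕ) * Real.log 2 ^ 2) * w ^ 4 := by
          gcongr
    _ ≤ Fmax * (C₀ * (2 + (2 : ℝ) ^ (19 : ℕ) * Real.log 2 ^ 2)) *
          ((N : ℝ) * Y / Real.sqrt w * (16 : ℝ) ^ Bd + w ^ 4) := by
          have h1 : 0 ≤ Fmax * C₀ * ((N : ℝ) * Y / Real.sqrt w * (16 : ℝ) ^ Bd) := by positivity
          have h2 : 0 ≤ Fmax * C₀ * w ^ 4 := by positivity
          have h3 : 0 ≤ Fmax * C₀ * ((2 : ℝ) ^ (19 : ℕ) * Real.log 2 ^ 2) *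
              ((N : ℝ) * Y / Real.sqrt w * (16 : ℝ) ^ Bd) := by positivity
          have heq : (N : ℝ) * Y * (1 / Real.sqrt w * (16 : ℝ) ^ Bd) = (N : ℝ) * Y / Real.sqrt w * (16 : ℝ) ^ Bd := by
            ring
          rw [heq]
          nlinarith

end PairShiu

end Literature.NumberTheory.Sieve
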